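import Summits.RiemannHypothesis.RiemannHypothesis.Theorems.GroundBartaEvenWinsBeyondArchDeflationRM80QFinalA
import Summits.RiemannHypothesis.RiemannHypothesis.Theorems.GroundBartaEvenWinsBeyondArchDeflationRM80QX01SA
import Summits.RiemannHypothesis.RiemannHypothesis.Theorems.GroundBartaEvenWinsBeyondArchDeflationRM80QX02SA
import Summits.RiemannHypothesis.RiemannHypothesis.Theorems.GroundBartaEvenWinsBeyondArchDeflationRM80QX12SA
import Summits.RiemannHypothesis.RiemannHypothesis.Theorems.GroundBartaEvenWinsBeyondArchDeflationRM80QX03SA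
import Summits.RiemannHypothesis.RiemannHypothesis.Theorems.GroundBartaEvenWinsBeyondArchDeflationRM80QX13SA
import Summits.RiemannHypothesis.RiemannHypothesis.Theorems.GroundBartaEvenWinsBeyondArchDeflationRM80QX23SA
import Summits.RiemannHypothesis.RiemannHypothesis.Theorems.GroundBartaEvenWinsBeyondArchDeflationRM80QWS0A
import Summits.RiemannHypothesis.RiemannHypothesis.Theorems.GroundBartaEvenWinsBeyondArchDeflationRM80QWS1A
import Summits.RiemannHypothesis.RiemannHypothesis.Theorems.GroundBartaEvenWinsBeyondArchDeflationRM80QWS2A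
import Summits.RiemannHypothesis.RiemannHypothesis.Theorems.GroundBartaEvenWinsBeyondArchDeflationRM80QWS3A
import Summits.RiemannHypothesis.RiemannHypothesis.Theorems.GroundBartaEvenWinsBeyondArchDeflationRM80QWS4A
import Summits.RiemannHypothesis.RiemannHypothesis.Theorems.GroundBartaEvenWinsBeyondArchDeflationRM80QWS5A
import Summits.RiemannHypothesis.RiemannHypothesis.Theorems.GroundBartaEvenWinsBeyondArchDeflationRM80QWX01SA
import Summits.RiemannHypothesis.RiemannHypothesis.Theorems.GroundBartaEvenWinsBeyondArchDeflationRM80QWX02SA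
import Summits.RiemannHypothesis.RiemannHypothesis.Theorems.GroundBartaEvenWinsBeyondArchDeflationRM80QWX12SA
import Summits.RiemannHypothesis.RiemannHypothesis.Theorems.GroundBartaEvenWinsBeyondArchDeflationRM80QWX03SA
import Summits.RiemannHypothesis.RiemannHypothesis.Theorems.GroundBartaEvenWinsBeyondArchDeflationRM80QWX13SA
import Summits.RiemannHypothesis.RiemannHypothesis.Theorems.GroundBartaEvenWinsBeyondArchDeflationRM80QWX23SA
import Summits.RiemannHypothesis.RiemannHypothesis.Theorems.GroundBartaEvenWinsBeyondArchDeflationM80PFinal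
import Summits.RiemannHypothesis.RiemannHypothesis.Theorems.GroundBartaEvenWinsBeyondArchDeflationCrossGlue2
import Summits.RiemannHypothesis.RiemannHypothesis.Theorems.GroundBartaEvenWinsBeyondArchDeflationWeightedPanels
import HarnessLib

/-!
# RiemannHypothesis / GroundBarta — rung 4 (`EvenWinsBeyondArch`): R-layer certificate `RM80Q` (b = 4023/5000) — bridge to prover A

Prover B (speedrun unit `sr-gb-rung-b`, gen 4).  The certified residual norms `q80hs0 … q80hs5` (`…RM80QFinalA`), the cross boxes
`q80x{ij}_bound` (`…RM80QX{ij}SA`) and their weighted versions (`…RM80QWS*`, `…RM80QWX*`) restated for prover A's trial vectors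
`m80Pv i = dt_wY (m80PP i) (4023/5000)` and window images `m80PF`: hypotheses of `dt_…_oddLower_of_gramT` / `…_of_gramW` with
`W := q80Wsig`, `s := q80s`, boxes `q80x..LO/HI`, weighted `q80sW`, `q80wx..LO/HI`.
-/

set_option linter.dupNamespace false

noncomputable section

open MeasureTheory Set Filter intervalIntegral
open scoped Topology BigOperators ComplexConjugate

namespace Summit.RiemannHypothesis.RiemannHypothesis.Theorems.EvenWinsBeyondArch

open Literature.NumberTheory.LFunctions
open Literature.Analysis.ValidatedNumerics Literature.Analysis.ValidatedNumerics.PolyMP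
  Literature.Analysis.ValidatedNumerics.NumericsMP Literature.Analysis.ValidatedNumerics.ExpPoly

/-- The coefficient matrix of the criterion: `W_il = W̃_il + [l = i] (M̃ − M_c)`. -/
def q80Wsig : Fin 6 → Fin 6 → ℝ := fun i l ↦
  (q80Wd i l : ℝ) + if l = i then (q80Mc : ℝ) - weilMarkovConstant ((4023 : ℝ) / 5000) else 0

/-- Prover A's and prover B's copies of the six dyadic vectors are the same lists. -/
theorem q80Pf_eq_m80PP : q80Pf = m80PP := by
  funext i
  fin_cases i <;> rfl

/-- `m80Pv l` is the window vector of the certificate. -/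
theorem m80Pv_eq_q80 (l : Fin 6) : m80Pv l = dt_wY (q80Pf l) q80c := by
  rw [q80Pf_eq_m80PP]; rfl

/-- the window constant as a cast -/
private theorem q80hc : ((q80c : ℚ) : ℝ) = ((4023 : ℝ) / 5000) := by norm_num [q80c]

/-- `m80Pv` in the R-layer's indicator form. -/
private theorem q80hv : ∀ l x, m80Pv l x = (((Icc (-(q80c : ℝ)) q80c).indicator (fun x ↦ Poly.eval (q80gp l) x) x : ℝ) : ℂ) := by
  intro l x; rw [m80Pv_eq_q80]; exact q80v_apply l x

/-- `m80PF` in the R-layer's `hF` form. -/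
private theorem q80hF : ∀ l y, m80PF l y = (Icc (-(q80c : ℝ)) q80c).indicator (fun y ↦
        2 * (∫ x, m80Pv l x * (Real.cosh (x / 2) : ℂ)) * (Real.cosh (y / 2) : ℂ) -
          2 * (∫ x, m80Pv l x * (Real.sinh (x / 2) : ℂ)) * (Real.sinh (y / 2) : ℂ) +
        (∑ n ∈ weilPrimeIndex (q80c : ℝ), (((ArithmeticFunction.vonMangoldt n : ℝ) / Real.sqrt n : ℝ) : ℂ) *
          (2 * m80Pv l y - m80Pv l (y - Real.log n) - m80Pv l (y + Real.log n))) +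
        ∫ t in Ioi 0, (weilArchDensity t : ℂ) * (2 * m80Pv l y - m80Pv l (y - t) - m80Pv l (y + t))) y -
      (weilMarkovConstant (q80c : ℝ) : ℂ) * m80Pv l y := by
  intro l y; rw [q80hc]; simp only [m80PF]

/-- The criterion matrix in the R-layer's generic form. -/
private theorem q80hW (i : Fin 6) : (fun l ↦ ((q80Wd i l : ℝ) + if l = i then (q80Mc : ℝ) - weilMarkovConstant (q80c : ℝ) else 0) • m80Pv l) =
    fun l ↦ q80Wsig i l • m80Pv l := by
  funext l; rw [q80hc]; rfl

/-- **Residual norm bounds** (hypothesis `hs`, `W := q80Wsig`, `s i := q80s i`). [cite: Bombieri2000Weil, Thm 2] -/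
theorem q80hs_m80P : ∀ i : Fin 6, ∫ x, ‖(m80PF i - ∑ l, q80Wsig i l • m80Pv l) x‖ ^ 2 ≤ ((q80s i : ℚ) : ℝ) := by
  have hF' : ∀ l y, m80PF l y = (Icc (-((4023 : ℝ) / 5000)) ((4023 : ℝ) / 5000)).indicator (fun y ↦
        2 * (∫ x, dt_wY (q80Pf l) q80c x * (Real.cosh (x / 2) : ℂ)) * (Real.cosh (y / 2) : ℂ) -
          2 * (∫ x, dt_wY (q80Pf l) q80c x * (Real.sinh (x / 2) : ℂ)) * (Real.sinh (y / 2) : ℂ) +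
        (∑ n ∈ weilPrimeIndex ((4023 : ℝ) / 5000), (((ArithmeticFunction.vonMangoldt n : ℝ) / Real.sqrt n : ℝ) : ℂ) *
          (2 * dt_wY (q80Pf l) q80c y - dt_wY (q80Pf l) q80c (y - Real.log n) - dt_wY (q80Pf l) q80c (y + Real.log n))) +
        ∫ t in Ioi 0, (weilArchDensity t : ℂ) * (2 * dt_wY (q80Pf l) q80c y - dt_wY (q80Pf l) q80c (y - t) - dt_wY (q80Pf l) q80c (y + t))) y -
      (weilMarkovConstant ((4023 : ℝ) / 5000) : ℂ) * dt_wY (q80Pf l) q80c y := by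
    intro l y
    simp only [m80PF, m80Pv_eq_q80]
  have hW' : ∀ i, (fun l ↦ q80Wsig i l • m80Pv l) =
      fun l ↦ ((q80Wd i l : ℝ) + if l = i then (q80Mc : ℝ) - weilMarkovConstant ((4023 : ℝ) / 5000) else 0) • dt_wY (q80Pf l) q80c := by
    intro i; funext l; rw [m80Pv_eq_q80]; rfl
  intro i
  fin_cases i
  · simp only [hW']; exact q80hs0 m80PF hF'
  · simp only [hW']; exact q80hs1 m80PF hF'
  · simp only [hW']; exact q80hs2 m80PF hF'
  · simp only [hW']; exact q80hs3 m80PF hF'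
  · simp only [hW']; exact q80hs4 m80PF hF'
  · simp only [hW']; exact q80hs5 m80PF hF'

/-- Cross term (0,1) (hypothesis `hR`, `∫ Re`, boxes `q80x01LO/HI`). -/
theorem q80hc01_m80P :
    ((q80x01LO : ℚ) : ℝ) ≤ ∫ x, ((m80PF 0 - ∑ l, q80Wsig 0 l • m80Pv l) x * conj ((m80PF 1 - ∑ l, q80Wsig 1 l • m80Pv l) x)).re ∧
      ∫ x, ((m80PF 0 - ∑ l, q80Wsig 0 l • m80Pv l) x * conj ((m80PF 1 - ∑ l, q80Wsig 1 l • m80Pv l) x)).re ≤ ((q80x01HI : ℚ) : ℝ) := by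
  have h := q80x01_bound m80Pv m80PF q80hv q80hF
  rw [q80hW 0, q80hW 1] at h
  rw [dt_cross_integral_re_L (gp := q80gp) (by norm_num [q80c]) q80hv q80hF q80Wsig 0 1]
  exact h

/-- Cross term (0,2) (hypothesis `hR`, `∫ Re`, boxes `q80x02LO/HI`). -/
theorem q80hc02_m80P :
    ((q80x02LO : ℚ) : ℝ) ≤ ∫ x, ((m80PF 0 - ∑ l, q80Wsig 0 l • m80Pv l) x * conj ((m80PF 2 - ∑ l, q80Wsig 2 l • m80Pv l) x)).re ∧
      ∫ x, ((m80PF 0 - ∑ l, q80Wsig 0 l • m80Pv l) x * conj ((m80PF 2 - ∑ l, q80Wsig 2 l • m80Pv l) x)).re ≤ ((q80x02HI : ℚ) : ℝ) := by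
  have h := q80x02_bound m80Pv m80PF q80hv q80hF
  rw [q80hW 0, q80hW 2] at h
  rw [dt_cross_integral_re_L (gp := q80gp) (by norm_num [q80c]) q80hv q80hF q80Wsig 0 2]
  exact h

/-- Cross term (1,2) (hypothesis `hR`, `∫ Re`, boxes `q80x12LO/HI`). -/
theorem q80hc12_m80P :
    ((q80x12LO : ℚ) : ℝ) ≤ ∫ x, ((m80PF 1 - ∑ l, q80Wsig 1 l • m80Pv l) x * conj ((m80PF 2 - ∑ l, q80Wsig 2 l • m80Pv l) x)).re ∧
      ∫ x, ((m80PF 1 - ∑ l, q80Wsig 1 l • m80Pv l) x * conj ((m80PF 2 - ∑ l, q80Wsig 2 l • m80Pv l) x)).re ≤ ((q80x12HI : ℚ) : ℝ) := by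
  have h := q80x12_bound m80Pv m80PF q80hv q80hF
  rw [q80hW 1, q80hW 2] at h
  rw [dt_cross_integral_re_L (gp := q80gp) (by norm_num [q80c]) q80hv q80hF q80Wsig 1 2]
  exact h

/-- Cross term (0,3) (hypothesis `hR`, `∫ Re`, boxes `q80x03LO/HI`). -/
theorem q80hc03_m80P :
    ((q80x03LO : ℚ) : ℝ) ≤ ∫ x, ((m80PF 0 - ∑ l, q80Wsig 0 l • m80Pv l) x * conj ((m80PF 3 - ∑ l, q80Wsig 3 l • m80Pv l) x)).re ∧
      ∫ x, ((m80PF 0 - ∑ l, q80Wsig 0 l • m80Pv l) x * conj ((m80PF 3 - ∑ l, q80Wsig 3 l • m80Pv l) x)).re ≤ ((q80x03HI : ℚ) : ℝ) := by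
  have h := q80x03_bound m80Pv m80PF q80hv q80hF
  rw [q80hW 0, q80hW 3] at h
  rw [dt_cross_integral_re_L (gp := q80gp) (by norm_num [q80c]) q80hv q80hF q80Wsig 0 3]
  exact h

/-- Cross term (1,3) (hypothesis `hR`, `∫ Re`, boxes `q80x13LO/HI`). -/
theorem q80hc13_m80P :
    ((q80x13LO : ℚ) : ℝ) ≤ ∫ x, ((m80PF 1 - ∑ l, q80Wsig 1 l • m80Pv l) x * conj ((m80PF 3 - ∑ l, q80Wsig 3 l • m80Pv l) x)).re ∧
      ∫ x, ((m80PF 1 - ∑ l, q80Wsig 1 l • m80Pv l) x * conj ((m80PF 3 - ∑ l, q80Wsig 3 l • m80Pv l) x)).re ≤ ((q80x13HI : ℚ) : ℝ) := by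
  have h := q80x13_bound m80Pv m80PF q80hv q80hF
  rw [q80hW 1, q80hW 3] at h
  rw [dt_cross_integral_re_L (gp := q80gp) (by norm_num [q80c]) q80hv q80hF q80Wsig 1 3]
  exact h

/-- Cross term (2,3) (hypothesis `hR`, `∫ Re`, boxes `q80x23LO/HI`). -/
theorem q80hc23_m80P :
    ((q80x23LO : ℚ) : ℝ) ≤ ∫ x, ((m80PF 2 - ∑ l, q80Wsig 2 l • m80Pv l) x * conj ((m80PF 3 - ∑ l, q80Wsig 3 l • m80Pv l) x)).re ∧
      ∫ x, ((m80PF 2 - ∑ l, q80Wsig 2 l • m80Pv l) x * conj ((m80PF 3 - ∑ l, q80Wsig 3 l • m80Pv l) x)).re ≤ ((q80x23HI : ℚ) : ℝ) := by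
  have h := q80x23_bound m80Pv m80PF q80hv q80hF
  rw [q80hW 2, q80hW 3] at h
  rw [dt_cross_integral_re_L (gp := q80gp) (by norm_num [q80c]) q80hv q80hF q80Wsig 2 3]
  exact h

/-- Conjugation symmetry, for the transposed pairs. -/
theorem q80hc_symm (i j : Fin 6) :
    ∫ x, ((m80PF j - ∑ l, q80Wsig j l • m80Pv l) x * conj ((m80PF i - ∑ l, q80Wsig i l • m80Pv l) x)).re = ∫ x, ((m80PF i - ∑ l, q80Wsig i l • m80Pv l) x * conj ((m80PF j - ∑ l, q80Wsig j l • m80Pv l) x)).re := by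
  rw [dt_cross_integral_re_L (gp := q80gp) (by norm_num [q80c]) q80hv q80hF q80Wsig j i,
    dt_cross_integral_re_L (gp := q80gp) (by norm_num [q80c]) q80hv q80hF q80Wsig i j, dt_cross_re_symm]

section Weighted

/-- the weighted bounds as a function `Fin 6 → ℚ` -/
def q80sW : Fin 6 → ℚ := ![q80sW0, q80sW1, q80sW2, q80sW3, q80sW4, q80sW5]

/-- **Weighted residual norms** (hypothesis `hsW` of `…_of_gramW`): for prover A's rationals `y₁, wI, wE` equal to the certificate's
`n₁·b/m`, `wI`, `wE`. -/
theorem q80whs_m80P (y₁ wI wE : ℚ) (hy : (y₁ : ℝ) = (((13 : ℚ) * (q80c / q80m) : ℚ) : ℝ)) (hwI : (wI : ℝ) = ((((25 : ℚ) / 17) : ℚ) : ℝ))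
    (hwE : (wE : ℝ) = ((((1250000 : ℚ) / 416783) : ℚ) : ℝ)) :
    ∀ i : Fin 6, ∫ y, {u : ℝ | (y₁ : ℝ) ≤ |u|}.piecewise (fun _ ↦ (wE : ℝ)) (fun _ ↦ (wI : ℝ)) y *
      ‖(m80PF i - ∑ l, q80Wsig i l • m80Pv l) y‖ ^ 2 ≤ ((q80sW i : ℚ) : ℝ) := by
  intro i
  have e : (fun y ↦ {u : ℝ | (y₁ : ℝ) ≤ |u|}.piecewise (fun _ ↦ (wE : ℝ)) (fun _ ↦ (wI : ℝ)) y) =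
      dt_wgt ((((13 : ℚ) * (q80c / q80m) : ℚ)) : ℝ) ((((25 : ℚ) / 17) : ℚ) : ℝ) ((((1250000 : ℚ) / 416783) : ℚ) : ℝ) := by
    funext y; rw [dt_wgt_eq, hy, hwI, hwE]
  simp only [show ∀ y, {u : ℝ | (y₁ : ℝ) ≤ |u|}.piecewise (fun _ ↦ (wE : ℝ)) (fun _ ↦ (wI : ℝ)) y =
      dt_wgt ((((13 : ℚ) * (q80c / q80m) : ℚ)) : ℝ) ((((25 : ℚ) / 17) : ℚ) : ℝ) ((((1250000 : ℚ) / 416783) : ℚ) : ℝ) y from fun y ↦ congrFun e y]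
  fin_cases i
  · have h := q80sW0_bound m80Pv m80PF q80hv q80hF; rw [q80hW 0] at h; simpa [q80sW] using h
  · have h := q80sW1_bound m80Pv m80PF q80hv q80hF; rw [q80hW 1] at h; simpa [q80sW] using h
  · have h := q80sW2_bound m80Pv m80PF q80hv q80hF; rw [q80hW 2] at h; simpa [q80sW] using h
  · have h := q80sW3_bound m80Pv m80PF q80hv q80hF; rw [q80hW 3] at h; simpa [q80sW] using h
  · have h := q80sW4_bound m80Pv m80PF q80hv q80hF; rw [q80hW 4] at h; simpa [q80sW] using h
  · have h := q80sW5_bound m80Pv m80PF q80hv q80hF; rw [q80hW 5] at h; simpa [q80sW] using h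

/-- Weighted cross term (0,1) (hypothesis `hR` of `…_of_gramW`). -/
theorem q80whc01_m80P (y₁ wI wE : ℚ) (hy : (y₁ : ℝ) = (((13 : ℚ) * (q80c / q80m) : ℚ) : ℝ)) (hwI : (wI : ℝ) = ((((25 : ℚ) / 17) : ℚ) : ℝ))
    (hwE : (wE : ℝ) = ((((1250000 : ℚ) / 416783) : ℚ) : ℝ)) :
    ((q80wx01LO : ℚ) : ℝ) ≤ ∫ y, {u : ℝ | (y₁ : ℝ) ≤ |u|}.piecewise (fun _ ↦ (wE : ℝ)) (fun _ ↦ (wI : ℝ)) y *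
        ((m80PF 0 - ∑ l, q80Wsig 0 l • m80Pv l) y * conj ((m80PF 1 - ∑ l, q80Wsig 1 l • m80Pv l) y)).re ∧
    ∫ y, {u : ℝ | (y₁ : ℝ) ≤ |u|}.piecewise (fun _ ↦ (wE : ℝ)) (fun _ ↦ (wI : ℝ)) y *
        ((m80PF 0 - ∑ l, q80Wsig 0 l • m80Pv l) y * conj ((m80PF 1 - ∑ l, q80Wsig 1 l • m80Pv l) y)).re ≤ ((q80wx01HI : ℚ) : ℝ) := by
  have e : (fun y ↦ {u : ℝ | (y₁ : ℝ) ≤ |u|}.piecewise (fun _ ↦ (wE : ℝ)) (fun _ ↦ (wI : ℝ)) y) =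
      dt_wgt ((((13 : ℚ) * (q80c / q80m) : ℚ)) : ℝ) ((((25 : ℚ) / 17) : ℚ) : ℝ) ((((1250000 : ℚ) / 416783) : ℚ) : ℝ) := by
    funext y; rw [dt_wgt_eq, hy, hwI, hwE]
  simp only [show ∀ y, {u : ℝ | (y₁ : ℝ) ≤ |u|}.piecewise (fun _ ↦ (wE : ℝ)) (fun _ ↦ (wI : ℝ)) y =
      dt_wgt ((((13 : ℚ) * (q80c / q80m) : ℚ)) : ℝ) ((((25 : ℚ) / 17) : ℚ) : ℝ) ((((1250000 : ℚ) / 416783) : ℚ) : ℝ) y from fun y ↦ congrFun e y]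
  have h := q80wx01_bound m80Pv m80PF q80hv q80hF
  rw [q80hW 0, q80hW 1] at h
  exact h

/-- Weighted cross term (0,2) (hypothesis `hR` of `…_of_gramW`). -/
theorem q80whc02_m80P (y₁ wI wE : ℚ) (hy : (y₁ : ℝ) = (((13 : ℚ) * (q80c / q80m) : ℚ) : ℝ)) (hwI : (wI : ℝ) = ((((25 : ℚ) / 17) : ℚ) : ℝ))
    (hwE : (wE : ℝ) = ((((1250000 : ℚ) / 416783) : ℚ) : ℝ)) :
    ((q80wx02LO : ℚ) : ℝ) ≤ ∫ y, {u : ℝ | (y₁ : ℝ) ≤ |u|}.piecewise (fun _ ↦ (wE : ℝ)) (fun _ ↦ (wI : ℝ)) y *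
        ((m80PF 0 - ∑ l, q80Wsig 0 l • m80Pv l) y * conj ((m80PF 2 - ∑ l, q80Wsig 2 l • m80Pv l) y)).re ∧
    ∫ y, {u : ℝ | (y₁ : ℝ) ≤ |u|}.piecewise (fun _ ↦ (wE : ℝ)) (fun _ ↦ (wI : ℝ)) y *
        ((m80PF 0 - ∑ l, q80Wsig 0 l • m80Pv l) y * conj ((m80PF 2 - ∑ l, q80Wsig 2 l • m80Pv l) y)).re ≤ ((q80wx02HI : ℚ) : ℝ) := by
  have e : (fun y ↦ {u : ℝ | (y₁ : ℝ) ≤ |u|}.piecewise (fun _ ↦ (wE : ℝ)) (fun _ ↦ (wI : ℝ)) y) =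
      dt_wgt ((((13 : ℚ) * (q80c / q80m) : ℚ)) : ℝ) ((((25 : ℚ) / 17) : ℚ) : ℝ) ((((1250000 : ℚ) / 416783) : ℚ) : ℝ) := by
    funext y; rw [dt_wgt_eq, hy, hwI, hwE]
  simp only [show ∀ y, {u : ℝ | (y₁ : ℝ) ≤ |u|}.piecewise (fun _ ↦ (wE : ℝ)) (fun _ ↦ (wI : ℝ)) y =
      dt_wgt ((((13 : ℚ) * (q80c / q80m) : ℚ)) : ℝ) ((((25 : ℚ) / 17) : ℚ) : ℝ) ((((1250000 : ℚ) / 416783) : ℚ) : ℝ) y from fun y ↦ congrFun e y]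
  have h := q80wx02_bound m80Pv m80PF q80hv q80hF
  rw [q80hW 0, q80hW 2] at h
  exact h

/-- Weighted cross term (1,2) (hypothesis `hR` of `…_of_gramW`). -/
theorem q80whc12_m80P (y₁ wI wE : ℚ) (hy : (y₁ : ℝ) = (((13 : ℚ) * (q80c / q80m) : ℚ) : ℝ)) (hwI : (wI : ℝ) = ((((25 : ℚ) / 17) : ℚ) : ℝ))
    (hwE : (wE : ℝ) = ((((1250000 : ℚ) / 416783) : ℚ) : ℝ)) :
    ((q80wx12LO : ℚ) : ℝ) ≤ ∫ y, {u : ℝ | (y₁ : ℝ) ≤ |u|}.piecewise (fun _ ↦ (wE : ℝ)) (fun _ ↦ (wI : ℝ)) y *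
        ((m80PF 1 - ∑ l, q80Wsig 1 l • m80Pv l) y * conj ((m80PF 2 - ∑ l, q80Wsig 2 l • m80Pv l) y)).re ∧
    ∫ y, {u : ℝ | (y₁ : ℝ) ≤ |u|}.piecewise (fun _ ↦ (wE : ℝ)) (fun _ ↦ (wI : ℝ)) y *
        ((m80PF 1 - ∑ l, q80Wsig 1 l • m80Pv l) y * conj ((m80PF 2 - ∑ l, q80Wsig 2 l • m80Pv l) y)).re ≤ ((q80wx12HI : ℚ) : ℝ) := by
  have e : (fun y ↦ {u : ℝ | (y₁ : ℝ) ≤ |u|}.piecewise (fun _ ↦ (wE : ℝ)) (fun _ ↦ (wI : ℝ)) y) =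
      dt_wgt ((((13 : ℚ) * (q80c / q80m) : ℚ)) : ℝ) ((((25 : ℚ) / 17) : ℚ) : ℝ) ((((1250000 : ℚ) / 416783) : ℚ) : ℝ) := by
    funext y; rw [dt_wgt_eq, hy, hwI, hwE]
  simp only [show ∀ y, {u : ℝ | (y₁ : ℝ) ≤ |u|}.piecewise (fun _ ↦ (wE : ℝ)) (fun _ ↦ (wI : ℝ)) y =
      dt_wgt ((((13 : ℚ) * (q80c / q80m) : ℚ)) : ℝ) ((((25 : ℚ) / 17) : ℚ) : ℝ) ((((1250000 : ℚ) / 416783) : ℚ) : ℝ) y from fun y ↦ congrFun e y]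
  have h := q80wx12_bound m80Pv m80PF q80hv q80hF
  rw [q80hW 1, q80hW 2] at h
  exact h

/-- Weighted cross term (0,3) (hypothesis `hR` of `…_of_gramW`). -/
theorem q80whc03_m80P (y₁ wI wE : ℚ) (hy : (y₁ : ℝ) = (((13 : ℚ) * (q80c / q80m) : ℚ) : ℝ)) (hwI : (wI : ℝ) = ((((25 : ℚ) / 17) : ℚ) : ℝ))
    (hwE : (wE : ℝ) = ((((1250000 : ℚ) / 416783) : ℚ) : ℝ)) :
    ((q80wx03LO : ℚ) : ℝ) ≤ ∫ y, {u : ℝ | (y₁ : ℝ) ≤ |u|}.piecewise (fun _ ↦ (wE : ℝ)) (fun _ ↦ (wI : ℝ)) y *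
        ((m80PF 0 - ∑ l, q80Wsig 0 l • m80Pv l) y * conj ((m80PF 3 - ∑ l, q80Wsig 3 l • m80Pv l) y)).re ∧
    ∫ y, {u : ℝ | (y₁ : ℝ) ≤ |u|}.piecewise (fun _ ↦ (wE : ℝ)) (fun _ ↦ (wI : ℝ)) y *
        ((m80PF 0 - ∑ l, q80Wsig 0 l • m80Pv l) y * conj ((m80PF 3 - ∑ l, q80Wsig 3 l • m80Pv l) y)).re ≤ ((q80wx03HI : ℚ) : ℝ) := by
  have e : (fun y ↦ {u : ℝ | (y₁ : ℝ) ≤ |u|}.piecewise (fun _ ↦ (wE : ℝ)) (fun _ ↦ (wI : ℝ)) y) =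
      dt_wgt ((((13 : ℚ) * (q80c / q80m) : ℚ)) : ℝ) ((((25 : ℚ) / 17) : ℚ) : ℝ) ((((1250000 : ℚ) / 416783) : ℚ) : ℝ) := by
    funext y; rw [dt_wgt_eq, hy, hwI, hwE]
  simp only [show ∀ y, {u : ℝ | (y₁ : ℝ) ≤ |u|}.piecewise (fun _ ↦ (wE : ℝ)) (fun _ ↦ (wI : ℝ)) y =
      dt_wgt ((((13 : ℚ) * (q80c / q80m) : ℚ)) : ℝ) ((((25 : ℚ) / 17) : ℚ) : ℝ) ((((1250000 : ℚ) / 416783) : ℚ) : ℝ) y from fun y ↦ congrFun e y]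
  have h := q80wx03_bound m80Pv m80PF q80hv q80hF
  rw [q80hW 0, q80hW 3] at h
  exact h

/-- Weighted cross term (1,3) (hypothesis `hR` of `…_of_gramW`). -/
theorem q80whc13_m80P (y₁ wI wE : ℚ) (hy : (y₁ : ℝ) = (((13 : ℚ) * (q80c / q80m) : ℚ) : ℝ)) (hwI : (wI : ℝ) = ((((25 : ℚ) / 17) : ℚ) : ℝ))
    (hwE : (wE : ℝ) = ((((1250000 : ℚ) / 416783) : ℚ) : ℝ)) :
    ((q80wx13LO : ℚ) : ℝ) ≤ ∫ y, {u : ℝ | (y₁ : ℝ) ≤ |u|}.piecewise (fun _ ↦ (wE : ℝ)) (fun _ ↦ (wI : ℝ)) y *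
        ((m80PF 1 - ∑ l, q80Wsig 1 l • m80Pv l) y * conj ((m80PF 3 - ∑ l, q80Wsig 3 l • m80Pv l) y)).re ∧
    ∫ y, {u : ℝ | (y₁ : ℝ) ≤ |u|}.piecewise (fun _ ↦ (wE : ℝ)) (fun _ ↦ (wI : ℝ)) y *
        ((m80PF 1 - ∑ l, q80Wsig 1 l • m80Pv l) y * conj ((m80PF 3 - ∑ l, q80Wsig 3 l • m80Pv l) y)).re ≤ ((q80wx13HI : ℚ) : ℝ) := by
  have e : (fun y ↦ {u : ℝ | (y₁ : ℝ) ≤ |u|}.piecewise (fun _ ↦ (wE : ℝ)) (fun _ ↦ (wI : ℝ)) y) =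
      dt_wgt ((((13 : ℚ) * (q80c / q80m) : ℚ)) : ℝ) ((((25 : ℚ) / 17) : ℚ) : ℝ) ((((1250000 : ℚ) / 416783) : ℚ) : ℝ) := by
    funext y; rw [dt_wgt_eq, hy, hwI, hwE]
  simp only [show ∀ y, {u : ℝ | (y₁ : ℝ) ≤ |u|}.piecewise (fun _ ↦ (wE : ℝ)) (fun _ ↦ (wI : ℝ)) y =
      dt_wgt ((((13 : ℚ) * (q80c / q80m) : ℚ)) : ℝ) ((((25 : ℚ) / 17) : ℚ) : ℝ) ((((1250000 : ℚ) / 416783) : ℚ) : ℝ) y from fun y ↦ congrFun e y]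
  have h := q80wx13_bound m80Pv m80PF q80hv q80hF
  rw [q80hW 1, q80hW 3] at h
  exact h

/-- Weighted cross term (2,3) (hypothesis `hR` of `…_of_gramW`). -/
theorem q80whc23_m80P (y₁ wI wE : ℚ) (hy : (y₁ : ℝ) = (((13 : ℚ) * (q80c / q80m) : ℚ) : ℝ)) (hwI : (wI : ℝ) = ((((25 : ℚ) / 17) : ℚ) : ℝ))
    (hwE : (wE : ℝ) = ((((1250000 : ℚ) / 416783) : ℚ) : ℝ)) :
    ((q80wx23LO : ℚ) : ℝ) ≤ ∫ y, {u : ℝ | (y₁ : ℝ) ≤ |u|}.piecewise (fun _ ↦ (wE : ℝ)) (fun _ ↦ (wI : ℝ)) y *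
        ((m80PF 2 - ∑ l, q80Wsig 2 l • m80Pv l) y * conj ((m80PF 3 - ∑ l, q80Wsig 3 l • m80Pv l) y)).re ∧
    ∫ y, {u : ℝ | (y₁ : ℝ) ≤ |u|}.piecewise (fun _ ↦ (wE : ℝ)) (fun _ ↦ (wI : ℝ)) y *
        ((m80PF 2 - ∑ l, q80Wsig 2 l • m80Pv l) y * conj ((m80PF 3 - ∑ l, q80Wsig 3 l • m80Pv l) y)).re ≤ ((q80wx23HI : ℚ) : ℝ) := by
  have e : (fun y ↦ {u : ℝ | (y₁ : ℝ) ≤ |u|}.piecewise (fun _ ↦ (wE : ℝ)) (fun _ ↦ (wI : ℝ)) y) =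
      dt_wgt ((((13 : ℚ) * (q80c / q80m) : ℚ)) : ℝ) ((((25 : ℚ) / 17) : ℚ) : ℝ) ((((1250000 : ℚ) / 416783) : ℚ) : ℝ) := by
    funext y; rw [dt_wgt_eq, hy, hwI, hwE]
  simp only [show ∀ y, {u : ℝ | (y₁ : ℝ) ≤ |u|}.piecewise (fun _ ↦ (wE : ℝ)) (fun _ ↦ (wI : ℝ)) y =
      dt_wgt ((((13 : ℚ) * (q80c / q80m) : ℚ)) : ℝ) ((((25 : ℚ) / 17) : ℚ) : ℝ) ((((1250000 : ℚ) / 416783) : ℚ) : ℝ) y from fun y ↦ congrFun e y]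
  have h := q80wx23_bound m80Pv m80PF q80hv q80hF
  rw [q80hW 2, q80hW 3] at h
  exact h

end Weighted

end Summit.RiemannHypothesis.RiemannHypothesis.Theorems.EvenWinsBeyondArch

end
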